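import Summits.HubbardSuperconductivity.HubbardSuperconductivity.Theorems.TwSourcedInertness.Negative.ThermalRowWalk

/-!
# `TwSourcedInertness` (stmt-HubbardSuperconductivity-1696) — negative lemmas V-a: the `u,v`
factorisation of the half-filled free torus and the thermal row walk with two-sided control

First of three files (`HalfFillingFactorisation` → `HalfFilling` → `HalfFillingTightness`) proving
that the open `μ`-window `μ₂ < 0` of the crux and the order `∀ [μ₁, μ₂] ∃ C` are LOAD-BEARING
(refuter, cdisprove cycle 3, 2026-08-16; census in `Cruxes/TwSourcedInertness/Disproof.lean` §K).

THE MECHANISM (exact, every torus): in the coordinates `k = (p + q, p − q)` — a bijection of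
`(ℤ/Lℤ)²` when `L` is odd (`uv_injective`), at most two-to-one in general (`uv_fibre`,
`sum_uv_le_two_mul_sum`) — the free data FACTORISE at `μ = 0`:
`ε_L(k) = −4 cos θ_p cos θ_q`, `ĝ_d(k) = −2 sin θ_p sin θ_q` (`θ_n = 2πn/L`; `torusBand_uv`,
`dWaveGap_uv`). K.2 re-runs the tree's thermal row walk (`TorusCooperSumRowWalk`) keeping the
two-sided control `1/β ≤ −2cos θ ≤ 1/4` on the walk (`cooperRow_thermal_walk`).
All statements spelled out (no definitions). [folklore]
-/

noncomputable section

namespace Summit.HubbardSuperconductivity.HubbardSuperconductivity.Theorems.TwSourcedInertness.Negative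

open Matrix Finset Literature.MathematicalPhysics.QuantumLattice Literature.Probability.LatticeModels

/-! ### K.1 Angles of residues; the `u,v` factorisation of the free data at half filling -/

/-- The angle `2π(a+b)/L` of a sum of residues is the sum of the angles up to a multiple of `2π`.
[folklore] -/
theorem exists_angle_add_eq {L : ℕ} [NeZero L] (a b : ZMod L) :
    ∃ n : ℕ, 2 * Real.pi * ((a + b).val : ℝ) / L =
      2 * Real.pi * (a.val : ℝ) / L + 2 * Real.pi * (b.val : ℝ) / L - n * (2 * Real.pi) := by
  refine ⟨(a.val + b.val) / L, ?_⟩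
  have hL : (L : ℝ) ≠ 0 := by exact_mod_cast NeZero.ne L
  have h1 : (((a + b).val : ℕ) : ℝ) = (a.val : ℝ) + b.val - L * (((a.val + b.val) / L : ℕ) : ℝ) := by
    have h := Nat.mod_add_div (a.val + b.val) L
    rw [ZMod.val_add]
    have h' : ((((a.val + b.val) % L : ℕ) : ℝ)) + (L : ℝ) * ((((a.val + b.val) / L : ℕ)) : ℝ) =
        (a.val : ℝ) + b.val := by
      exact_mod_cast h
    linarith
  rw [h1]
  field_simp

/-- `cos`/`sin` of the angle of `a + b`. [folklore] -/
theorem cos_sin_angle_add {L : ℕ} [NeZero L] (θ : ZMod L → ℝ)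
    (hθ : ∀ a, θ a = 2 * Real.pi * (a.val : ℝ) / L) (a b : ZMod L) :
    Real.cos (θ (a + b)) = Real.cos (θ a + θ b) ∧ Real.sin (θ (a + b)) = Real.sin (θ a + θ b) := by
  obtain ⟨n, hn⟩ := exists_angle_add_eq a b
  rw [hθ, hθ a, hθ b, hn, Real.cos_sub_nat_mul_two_pi, Real.sin_sub_nat_mul_two_pi]
  exact ⟨rfl, rfl⟩

/-- `cos`/`sin` of the angle of `a - b`. [folklore] -/
theorem cos_sin_angle_sub {L : ℕ} [NeZero L] (θ : ZMod L → ℝ)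
    (hθ : ∀ a, θ a = 2 * Real.pi * (a.val : ℝ) / L) (a b : ZMod L) :
    Real.cos (θ (a - b)) = Real.cos (θ a - θ b) ∧ Real.sin (θ (a - b)) = Real.sin (θ a - θ b) := by
  obtain ⟨hc, hs⟩ := cos_sin_angle_add θ hθ (a - b) b
  rw [sub_add_cancel] at hc hs
  constructor
  · rw [Real.cos_sub, hc, hs, ← Real.cos_sub, add_sub_cancel_right]
  · rw [Real.sin_sub, hc, hs, ← Real.sin_sub, add_sub_cancel_right]

/-- **Half-filling factorisation of the band**: `ε_L(p+q, p−q) = −4 cos θ_p cos θ_q`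
(`θ_n = 2πn/L`; `cos(u+v) + cos(u−v) = 2 cos u cos v`). [folklore] -/
theorem torusBand_uv {L : ℕ} [NeZero L] (θ : ZMod L → ℝ)
    (hθ : ∀ a, θ a = 2 * Real.pi * (a.val : ℝ) / L) (p q : ZMod L) :
    torusBand L (![p + q, p - q] : TorusSite 2 L) = -4 * Real.cos (θ p) * Real.cos (θ q) := by
  have h1 := (cos_sin_angle_add θ hθ p q).1
  have h2 := (cos_sin_angle_sub θ hθ p q).1
  rw [hθ (p + q)] at h1
  rw [hθ (p - q)] at h2
  simp only [torusBand, latticeMomentum, Fin.sum_univ_two, Matrix.cons_val_zero, Matrix.cons_val_one,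
    Matrix.cons_val_fin_one]
  rw [h1, h2, Real.cos_add, Real.cos_sub]
  ring

/-- **Half-filling factorisation of the `d`-wave form factor**: `ĝ_d(p+q, p−q) = −2 sin θ_p sin θ_q`
(`cos(u+v) − cos(u−v) = −2 sin u sin v`). [folklore] -/
theorem dWaveGap_uv {L : ℕ} [NeZero L] (θ : ZMod L → ℝ)
    (hθ : ∀ a, θ a = 2 * Real.pi * (a.val : ℝ) / L) (p q : ZMod L) :
    dWaveGap (![p + q, p - q] : TorusSite 2 L) = -2 * Real.sin (θ p) * Real.sin (θ q) := by
  have h1 := (cos_sin_angle_add θ hθ p q).1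
  have h2 := (cos_sin_angle_sub θ hθ p q).1
  rw [hθ (p + q)] at h1
  rw [hθ (p - q)] at h2
  simp only [dWaveGap, latticeMomentum, Matrix.cons_val_zero, Matrix.cons_val_one,
    Matrix.cons_val_fin_one]
  rw [h1, h2, Real.cos_add, Real.cos_sub]
  ring

/-- On an ODD torus `(p, q) ↦ (p + q, p − q)` is injective (`2` is a unit mod `L`). [folklore] -/
theorem uv_injective {L : ℕ} [NeZero L] (hL : Odd L) :
    Function.Injective (fun pq : ZMod L × ZMod L => (![pq.1 + pq.2, pq.1 - pq.2] : TorusSite 2 L)) := by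
  rintro ⟨p, q⟩ ⟨p', q'⟩ h
  have h0 := congrFun h 0
  have h1 := congrFun h 1
  simp only [Matrix.cons_val_zero, Matrix.cons_val_one, Matrix.cons_val_fin_one] at h0 h1
  have hu : IsUnit ((2 : ℕ) : ZMod L) :=
    (ZMod.isUnit_iff_coprime 2 L).2 (Nat.coprime_two_left.2 hL)
  have hp : ((2 : ℕ) : ZMod L) * p = ((2 : ℕ) : ZMod L) * p' := by
    push_cast
    linear_combination h0 + h1
  have hq : ((2 : ℕ) : ZMod L) * q = ((2 : ℕ) : ZMod L) * q' := by
    push_cast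
    linear_combination h0 - h1
  exact Prod.ext (hu.mul_right_inj.1 hp) (hu.mul_right_inj.1 hq)

/-- In `ℤ/Lℤ`, `2t = 0` forces `t ∈ {0, ⌊L/2⌋}`. [folklore] -/
theorem eq_zero_or_eq_half_of_two_mul_eq_zero {L : ℕ} [NeZero L] {t : ZMod L} (ht : 2 * t = 0) :
    t = 0 ∨ t = ((L / 2 : ℕ) : ZMod L) := by
  have hv : ((2 * t.val : ℕ) : ZMod L) = 0 := by
    push_cast
    rw [ZMod.natCast_zmod_val]
    exact ht
  rw [ZMod.natCast_eq_zero_iff] at hv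
  obtain ⟨c, hc⟩ := hv
  have hlt := ZMod.val_lt t
  rcases Nat.lt_or_ge c 2 with h2 | h2
  · interval_cases c
    · left
      rw [mul_zero] at hc
      have : t.val = 0 := by omega
      exact (ZMod.val_eq_zero t).1 this
    · right
      rw [mul_one] at hc
      have : t.val = L / 2 := by omega
      rw [← ZMod.natCast_zmod_val t, this]
  · exfalso
    have := Nat.mul_le_mul_left L h2
    omega

/-- The fibres of `(p, q) ↦ (p + q, p − q)` have at most two points:
`(p', q') ∈ {(p, q), (p − c, q − c)}`, `c = ⌊L/2⌋`. [folklore] -/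
theorem uv_fibre {L : ℕ} [NeZero L] (p q p' q' : ZMod L)
    (h : (![p' + q', p' - q'] : TorusSite 2 L) = ![p + q, p - q]) :
    (p', q') = (p, q) ∨ (p', q') = (p - ((L / 2 : ℕ) : ZMod L), q - ((L / 2 : ℕ) : ZMod L)) := by
  have h0 := congrFun h 0
  have h1 := congrFun h 1
  simp only [Matrix.cons_val_zero, Matrix.cons_val_one, Matrix.cons_val_fin_one] at h0 h1
  have ht : 2 * (p - p') = 0 := by linear_combination -h0 - h1
  have hq' : q' = q - (p - p') := by linear_combination -h1
  have hp' : p' = p - (p - p') := by ring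
  rcases eq_zero_or_eq_half_of_two_mul_eq_zero ht with h | h
  · left
    rw [h, sub_zero] at hq'
    have : p' = p := by rw [hp', h, sub_zero]
    rw [this, hq']
  · right
    rw [h] at hq' hp'
    rw [← hp', ← hq']

/-- **At most two-to-one**: for nonnegative `F`,
`Σ_{(p,q) ∈ S} F(p+q, p−q) ≤ 2 Σ_k F(k)` on EVERY torus (odd `L`: the map is a bijection,
`uv_injective`; even `L`: fibres `{(p,q), (p + L/2, q + L/2)}`). [folklore] -/
theorem sum_uv_le_two_mul_sum {L : ℕ} [NeZero L] (S : Finset (ZMod L × ZMod L))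
    (F : TorusSite 2 L → ℝ) (hF : ∀ k, 0 ≤ F k) :
    ∑ x ∈ S, F ![x.1 + x.2, x.1 - x.2] ≤ 2 * ∑ k, F k := by
  rw [← Finset.sum_fiberwise_of_maps_to (s := S) (t := Finset.univ)
    (g := fun x : ZMod L × ZMod L => (![x.1 + x.2, x.1 - x.2] : TorusSite 2 L))
    (fun x _ => Finset.mem_univ _), Finset.mul_sum]
  refine Finset.sum_le_sum fun k _ => ?_
  have hcong : ∑ x ∈ S with (![x.1 + x.2, x.1 - x.2] : TorusSite 2 L) = k,
      F ![x.1 + x.2, x.1 - x.2] =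
      ∑ x ∈ S with (![x.1 + x.2, x.1 - x.2] : TorusSite 2 L) = k, F k :=
    Finset.sum_congr rfl fun x hx => by rw [(Finset.mem_filter.1 hx).2]
  rw [hcong, Finset.sum_const, nsmul_eq_mul]
  have hcard : ((S.filter (fun x : ZMod L × ZMod L =>
      (![x.1 + x.2, x.1 - x.2] : TorusSite 2 L) = k)).card : ℝ) ≤ 2 := by
    by_cases hne : (S.filter (fun x : ZMod L × ZMod L =>
        (![x.1 + x.2, x.1 - x.2] : TorusSite 2 L) = k)).Nonempty
    · obtain ⟨⟨p, q⟩, hpq⟩ := hne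
      have hk : (![p + q, p - q] : TorusSite 2 L) = k := (Finset.mem_filter.1 hpq).2
      have hsub : S.filter (fun x : ZMod L × ZMod L => (![x.1 + x.2, x.1 - x.2] : TorusSite 2 L) = k) ⊆
          {(p, q), (p - ((L / 2 : ℕ) : ZMod L), q - ((L / 2 : ℕ) : ZMod L))} := by
        rintro ⟨p', q'⟩ h'
        have hk' : (![p' + q', p' - q'] : TorusSite 2 L) = k := (Finset.mem_filter.1 h').2
        have hfib := uv_fibre p q p' q' (hk'.trans hk.symm)
        simp only [Finset.mem_insert, Finset.mem_singleton]
        exact hfib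
      calc ((S.filter (fun x : ZMod L × ZMod L =>
              (![x.1 + x.2, x.1 - x.2] : TorusSite 2 L) = k)).card : ℝ)
          ≤ (({(p, q), (p - ((L / 2 : ℕ) : ZMod L), q - ((L / 2 : ℕ) : ZMod L))} :
              Finset (ZMod L × ZMod L)).card : ℝ) := by exact_mod_cast Finset.card_le_card hsub
        _ ≤ 2 := by exact_mod_cast Finset.card_le_two
    · rw [Finset.not_nonempty_iff_eq_empty.1 hne, Finset.card_empty]
      norm_num
  nlinarith [hF k]

/-! ### K.2 The thermal row walk with two-sided control (window version of `cooperRow_thermal_sum_ge`) -/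

/-- **One row, thermal cutoff, inside the window.** For `|c| ≤ 3/2`, `L ≥ 400`, `β ≥ 128`, `L ≥ 2β`
there is a set `W ⊆ {0,…,L−1}` of row indices on which the row energy
`g(n) = −2cos(2πn/L) + c` satisfies `1/β ≤ g(n) ≤ 1/4` and `Σ_{n∈W} 1/g(n) ≥ (L/(4π))(log β − log 128)`
(the walk `n₀ + j`, `j ∈ [⌈L/β⌉, ⌊L/64⌋]` of the tree's `cooperRow_walk_bounds`). [folklore] -/
theorem cooperRow_thermal_walk {L : ℕ} {c β : ℝ} (g : ℕ → ℝ)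
    (hg : ∀ n : ℕ, g n = -2 * Real.cos (2 * Real.pi * (n : ℝ) / L) + c) (hc : |c| ≤ 3 / 2)
    (hL : (400 : ℝ) ≤ L) (hβ : 128 ≤ β) (hLβ : 2 * β ≤ L) :
    ∃ W : Finset ℕ, W ⊆ Finset.range L ∧ (∀ n ∈ W, 1 / β ≤ g n ∧ g n ≤ 1 / 4) ∧
      (L : ℝ) / (4 * Real.pi) * (Real.log β - Real.log 128) ≤ ∑ n ∈ W, 1 / g n := by
  have hπ := Real.pi_pos
  have hπ3 := Real.pi_lt_d2
  have hβ0 : 0 < β := by linarith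
  have hLr : (0 : ℝ) < L := by linarith
  have hs : (0 : ℝ) < 1 := one_pos
  have hc' : |c| ≤ 2 - (1 : ℝ) ^ 2 / 2 := by norm_num; linarith
  have hL' : 400 / (1 : ℝ) ^ 2 ≤ (L : ℝ) := by rw [one_pow, div_one]; exact hL
  obtain ⟨n₀, _hn₀1, hn₀L, hg0, hg1, hcos⟩ := exists_cooperRow_crossing (c := c) hs le_rfl hc' hL'
  set R : ℕ := ⌊(L : ℝ) / 64⌋₊ with hR
  have hRle : (R : ℝ) ≤ (1 : ℝ) ^ 2 * L / 64 := by
    rw [one_pow, one_mul]; exact Nat.floor_le (by positivity)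
  have hRge : (L : ℝ) / 64 < R + 1 := Nat.lt_floor_add_one _
  set j₀ : ℕ := ⌈(L : ℝ) / β⌉₊ with hj₀
  have hj₀ge : (L : ℝ) / β ≤ j₀ := Nat.le_ceil _
  have hj₀lt : (j₀ : ℝ) < L / β + 1 := Nat.ceil_lt_add_one (by positivity)
  have hLβ' : 2 ≤ (L : ℝ) / β := by rw [le_div_iff₀ hβ0]; linarith
  have hLβ128 : (L : ℝ) / β ≤ L / 128 := div_le_div_of_nonneg_left hLr.le (by norm_num) hβ
  have hL128 : (1 : ℝ) ≤ L / 128 := by rw [le_div_iff₀ (by norm_num)]; linarith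
  have hj₀R : j₀ ≤ R := by
    have h1 : (j₀ : ℝ) < R + 1 := by
      have : (L : ℝ) / 64 = L / 128 + L / 128 := by ring
      linarith
    have h2 : j₀ < R + 1 := by exact_mod_cast h1
    omega
  -- along the walk: `1/β ≤ g ≤ 4π(j+1)/L ≤ 1/4`
  have hwalk : ∀ j ∈ Finset.Ico j₀ (R + 1),
      1 / β ≤ g (n₀ + j) ∧ g (n₀ + j) ≤ 1 / 4 := by
    intro j hj
    rw [Finset.mem_Ico] at hj
    have hjR : j ≤ R := by omega
    obtain ⟨hb1, hb2⟩ := cooperRow_walk_bounds (c := c) hs le_rfl hL' hn₀L hcos hRle hg0 hg1 hjR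
    rw [← hg (n₀ + j)] at hb1 hb2
    refine ⟨?_, hb2.trans ?_⟩
    · have hj1 : (j₀ : ℝ) ≤ j := by exact_mod_cast hj.1
      calc 1 / β = (L / β) / L := by field_simp
        _ ≤ (j₀ : ℝ) / L := by gcongr
        _ ≤ 1 * (j : ℝ) / L := by rw [one_mul]; gcongr
        _ ≤ g (n₀ + j) := hb1
    · have hjR' : (j : ℝ) + 1 ≤ L / 64 + 1 := by
        have : (j : ℝ) ≤ R := by exact_mod_cast hjR
        rw [one_pow, one_mul] at hRle
        linarith
      rw [div_le_iff₀ hLr]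
      calc 4 * Real.pi * ((j : ℝ) + 1) ≤ 4 * Real.pi * (L / 64 + 1) :=
            mul_le_mul_of_nonneg_left hjR' (by positivity)
        _ = Real.pi / 16 * L + 4 * Real.pi := by ring
        _ ≤ 3.15 / 16 * L + 4 * 3.15 := by nlinarith
        _ ≤ 1 / 4 * L := by nlinarith
  refine ⟨(Finset.Ico j₀ (R + 1)).image (fun j => n₀ + j), ?_, ?_, ?_⟩
  · -- inside `range L`
    intro n hn
    rw [Finset.mem_image] at hn
    obtain ⟨j, hj, rfl⟩ := hn
    rw [Finset.mem_Ico] at hj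
    rw [Finset.mem_range]
    have hjR : (j : ℝ) ≤ L / 64 := by
      have : (j : ℝ) ≤ R := by exact_mod_cast (show j ≤ R by omega)
      rw [one_pow, one_mul] at hRle
      linarith
    have h2n : 2 * (n₀ : ℝ) ≤ L := by exact_mod_cast hn₀L
    have : (n₀ : ℝ) + j < L := by linarith
    exact_mod_cast this
  · intro n hn
    rw [Finset.mem_image] at hn
    obtain ⟨j, hj, rfl⟩ := hn
    exact hwalk j hj
  · have hinj : Set.InjOn (fun j => n₀ + j) ↑(Finset.Ico j₀ (R + 1)) := fun a _ b _ h => by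
      simpa using h
    -- the harmonic sum
    have hharm : Real.log β - Real.log 128 ≤ ∑ j ∈ Finset.Ico j₀ (R + 1), 1 / ((j : ℝ) + 1) := by
      have h1 : 1 ≤ j₀ + 1 := by omega
      have h2 : j₀ + 1 ≤ R + 2 := by omega
      have key := log_sub_log_le_sum_Ico_one_div h1 h2
      have hre : ∑ i ∈ Finset.Ico (j₀ + 1) (R + 2), (1 : ℝ) / i =
          ∑ j ∈ Finset.Ico j₀ (R + 1), 1 / ((j : ℝ) + 1) := by
        rw [Finset.sum_Ico_eq_sum_range, Finset.sum_Ico_eq_sum_range,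
          show R + 2 - (j₀ + 1) = R + 1 - j₀ by omega]
        refine Finset.sum_congr rfl fun k _ => ?_
        push_cast
        ring
      rw [hre] at key
      have hA : Real.log ((L : ℝ) / 64) ≤ Real.log ((R + 2 : ℕ) : ℝ) := by
        refine Real.log_le_log (by positivity) ?_
        push_cast; linarith
      have hB : Real.log ((j₀ + 1 : ℕ) : ℝ) ≤ Real.log (2 * L / β) := by
        refine Real.log_le_log (by positivity) ?_
        have e2 : (2 : ℝ) * L / β = L / β + L / β := by ring
        push_cast; linarith
      have hC : Real.log ((L : ℝ) / 64) - Real.log (2 * L / β) = Real.log β - Real.log 128 := by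
        rw [← Real.log_div (by positivity) (by positivity), ← Real.log_div hβ0.ne' (by norm_num)]
        congr 1
        field_simp
        ring
      linarith
    calc (L : ℝ) / (4 * Real.pi) * (Real.log β - Real.log 128)
        ≤ (L : ℝ) / (4 * Real.pi) * ∑ j ∈ Finset.Ico j₀ (R + 1), 1 / ((j : ℝ) + 1) :=
          mul_le_mul_of_nonneg_left hharm (by positivity)
      _ = ∑ j ∈ Finset.Ico j₀ (R + 1), (L : ℝ) / (4 * Real.pi) * (1 / ((j : ℝ) + 1)) := by
          rw [Finset.mul_sum]
      _ ≤ ∑ j ∈ Finset.Ico j₀ (R + 1), 1 / g (n₀ + j) := by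
          refine Finset.sum_le_sum fun j hj => ?_
          have hjm := hj
          rw [Finset.mem_Ico] at hj
          have hjR : j ≤ R := by omega
          obtain ⟨hb1, hb2⟩ := cooperRow_walk_bounds (c := c) hs le_rfl hL' hn₀L hcos hRle hg0 hg1 hjR
          rw [← hg (n₀ + j)] at hb1 hb2
          have h1 := (hwalk j hjm).1
          have hgpos : 0 < g (n₀ + j) := lt_of_lt_of_le (by positivity) h1
          rw [show (L : ℝ) / (4 * Real.pi) * (1 / ((j : ℝ) + 1)) = 1 / (4 * Real.pi * (j + 1) / L) by
            field_simp]
          exact one_div_le_one_div_of_le hgpos hb2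
      _ = ∑ n ∈ (Finset.Ico j₀ (R + 1)).image (fun j => n₀ + j), 1 / g n := by
          rw [Finset.sum_image hinj]


end Summit.HubbardSuperconductivity.HubbardSuperconductivity.Theorems.TwSourcedInertness.Negative
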